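import Summits.BirchSwinnertonDyer.BirchSwinnertonDyer.Theorems.KatoDescentTamePotSupersingularJetchevIrreducibleReadingDivisibilityCoreVertexBridge
import HarnessLib

/-!
# Crux `JetchevIrreducibleReadingByName` (item 20165, shared K8-t′ / K9, cell `bsd-potss`): the image-free road-K
# BRIDGE RE-ISSUED over the PRIMED readings `stub_prop52IrredP` / `stub_coreVertexExistenceIrredP` (one extra row
# binder `(p : ℤ) ∣ W.conductorNorm ℤ`, planner g22's v5 `plan/edit-g22/bc/JetchevIrreducibleReadingByName_v5_primedSigs.lean`)
# — seat `bsd-potss-k9-c4` g8 answering plan g22's «bridge re-issue» ask (STATUS 09:23Z / INBOX 09:52Z); route-free;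
# `--supports 20165`, helper; nothing booked, no item closed, BSD is not proved by any of this

WHY. k8t-c4 g9 (FINDING-20165-cebotarev-irreducible §3) showed that the Čebotarev halves of McCallum Prop. 5.2 / Jetchev
Prop. 5.3 in the irreducible reading are served on the rows `p ∣ N_E` (theorem
`JetchevIrreducibleCebotarev.cor32_localOrder_of_irreducible_of_heegner`) while the displayed stubs `stub_prop52Irred` /
`stub_coreVertexExistenceIrred` of skeleton v3/v4 omit `p ∣ N_E` (off-row corner `K = ℚ(√−p)` benign but unserved);
the planner's v5 adds the free binder and waits for the bridge of p504855 to be re-issued over the primed forms. This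
file is that re-issue, VERBATIM k8t-c4 g8's `…DivisibilityCoreVertexBridge` §3–§4 and `…DivisibilityBridge` §2 with
the one extra binder threaded through (`p ∣ N_E` is available in every use: it is DERIVED from `Addv` in §3):

* §1 `exists_coreVertex_of_coreVertexExistenceIrredP` — `h64` (core vertices of every level) from the PRIMED `hCVI`;
* §2 `prop52Row_of_prop52IrredP` — `h52row` from the PRIMED `h52I`;
* §3 `divisibilityIrredAddv_of_prop52IrredP_of_coreVertexExistenceIrredP_of_thm63` — S2 of 20165 (`Sig.S2DivisibilityIrredAddv`
  body VERBATIM) from the primed readings, `hRCF` and the unchanged `H63I` (`Sig.H63IRowObjectsAddv`).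
The K9 `q = p` twin (19941's S2p over the primed readings) is the sequel `…WildJetchevBoundAtPCoreVertexBridgePrimed`.
CONDITIONAL on the displayed readings; nothing asserted; 20165, its stubs and BSD stay open.

References: [cite: Jetchev2008, Prop. 5.3 (p. 823), Thm. 5.2 (p. 821), Rem. 6.2, proof of Thm. 1.1 (p. 824)]
[cite: McCallumLMS1991, §3 Cor. 3.2, §5 Prop. 5.2 (p. 304)] [cite: GrossLMS1991, §4 Lemma 4.3].
-/

set_option autoImplicit false
-- the Theorems directory repeats the summit name (sibling precedent `KatoDescentPotSupersingularAssembly.lean`)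
set_option linter.dupNamespace false

noncomputable section

open scoped Classical

namespace Summit.BirchSwinnertonDyer.BirchSwinnertonDyer.Theorems.JetchevIrreducibleReadingDivisibilityPrimed

open WeierstrassCurve Literature.NumberTheory.EllipticCurves
  Literature.NumberTheory.EllipticCurves.ModularForms
  Literature.NumberTheory.EllipticCurves.Rank1Residual
  Summit.BirchSwinnertonDyer.Rank1Residual Summit.BirchSwinnertonDyer.Rank1Residual.JET
  Summit.BirchSwinnertonDyer.BirchSwinnertonDyer.Theorems.JetchevIrreducibleReadingDivisibility

/-! ### §1 Core vertices of every level from the PRIMED irreducible reading of Jetchev Prop. 5.3 -/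

/-- **`h64` for a row with `E[p]` IRREDUCIBLE and `p ∣ N_E`, from the PRIMED reading `hCVI`** (=
`Sig.stub_coreVertexExistenceIrredP`: k8t-c4 g8's `hCVI` with the extra row binder `(p : ℤ) ∣ W.conductorNorm ℤ`).
Proof byte-identical to `exists_coreVertex_of_coreVertexExistenceIrred` (the no-`p`-torsion step from x11b3's
irreducible theorem), the binder fed from `hpN`. CONDITIONAL on `hCVI`; nothing asserted.
[cite: Jetchev2008, Prop. 5.3 (p. 823), Lemma 5.1 and Rem. 6.2] [cite: GrossLMS1991, §4, Lemma 4.3] -/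
theorem exists_coreVertex_of_coreVertexExistenceIrredP
    (hCVI : ∀ (W : WeierstrassCurve ℚ) [W.IsElliptic] [W.IsGloballyMinimal] [NeZero (W.conductorNorm ℤ)],
        ¬ W.HasCM →
        ∀ (K : Type) [Field K] [NumberField K], IsImaginaryQuadratic K →
        NumberField.discr K ≠ -3 → NumberField.discr K ≠ -4 →
        SatisfiesHeegnerHypothesis (W.conductorNorm ℤ) K →
        ∀ (τ : K ≃ₐ[ℚ] K), τ ≠ 1 →
        ∀ (p : ℕ) [Fact p.Prime], p ≠ 2 → W.HasIrreducibleModPGaloisRep p → (p : ℤ) ∣ W.conductorNorm ℤ →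
        ∀ (Dt : ModularParametrizationData W (W.conductorNorm ℤ)) (β : ℤ) (ι : K →+* ℂ)
          [∀ k : ℕ, NumberField (ringClassField K ι k)]
          (d₁ : KolyvaginHeegnerData Dt β ι 1), ¬ IsOfFinAddOrder d₁.derivedPoint →
        ∀ (m : ℕ), 1 ≤ m →
        ∀ (c : ℕ) (d : KolyvaginHeegnerData Dt β ι c), Squarefree c →
          (∀ ℓ ∈ c.primeFactors, Zhang2014.IsKolyvaginPrime (W.conductorNorm ℤ) W K p ℓ) →
        ∀ (s : ℕ), ¬ IsOfFinAddOrder d.derivedPoint →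
          (∃ Q : (W.baseChange (ringClassField K ι c)).toAffine.Point,
            ((p ^ s : ℕ) : ℤ) • Q = d.derivedPoint) →
          (¬ ∃ Q : (W.baseChange (ringClassField K ι c)).toAffine.Point,
            ((p ^ (s + 1) : ℕ) : ℤ) • Q = d.derivedPoint) →
          ((s + m : ℕ) : ℕ∞) ≤ Zhang2014.levelIndex W p c →
          ∃ (c' : ℕ) (d' : KolyvaginHeegnerData Dt β ι c'), Squarefree c' ∧
            (∀ ℓ ∈ c'.primeFactors, Zhang2014.IsKolyvaginPrime (W.conductorNorm ℤ) W K p ℓ ∧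
              m + s ≤ Zhang2014.kolyvaginIndex W p ℓ) ∧
            Jetchev2008.IsGlobalCoreVertex W K ι τ p m c' ∧
            ¬ IsOfFinAddOrder d'.derivedPoint ∧
            ¬ ∃ Q : (W.baseChange (ringClassField K ι c')).toAffine.Point,
              ((p ^ (s + 1) : ℕ) : ℤ) • Q = d'.derivedPoint)
    (W : WeierstrassCurve ℚ) [W.IsElliptic] [W.IsGloballyMinimal] [NeZero (W.conductorNorm ℤ)]
    (hcm : ¬ W.HasCM) (K : Type) [Field K] [NumberField K] (hK : IsImaginaryQuadratic K)
    (hD3 : NumberField.discr K ≠ -3) (hD4 : NumberField.discr K ≠ -4)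
    (hH : SatisfiesHeegnerHypothesis (W.conductorNorm ℤ) K)
    (τ : K ≃ₐ[ℚ] K) (hτ : τ ≠ 1)
    (p : ℕ) [Fact p.Prime] (hp2 : p ≠ 2) (hirr : W.HasIrreducibleModPGaloisRep p)
    (hpN : p ∣ W.conductorNorm ℤ)
    (Dt : ModularParametrizationData W (W.conductorNorm ℤ)) (β : ℤ) (ι : K →+* ℂ)
    [∀ k : ℕ, NumberField (ringClassField K ι k)]
    (d₁ : KolyvaginHeegnerData Dt β ι 1) (hy : ¬ IsOfFinAddOrder d₁.derivedPoint)
    (mdiv m : {c : ℕ // Squarefree c ∧ ∀ ℓ ∈ c.primeFactors,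
      Zhang2014.IsKolyvaginPrime (W.conductorNorm ℤ) W K p ℓ} → ℕ∞)
    (hchar : ∀ c (u : ℕ), (u : ℕ∞) ≤ mdiv c ↔ ∀ d : KolyvaginHeegnerData Dt β ι c.1,
      ∃ Q : (W.baseChange (ringClassField K ι c.1)).toAffine.Point,
        ((p ^ u : ℕ) : ℤ) • Q = d.derivedPoint)
    (hmdef : ∀ c, m c = if mdiv c < Zhang2014.levelIndex W p c.1 then mdiv c else ⊤)
    (mInf k : ℕ) (c : {c : ℕ // Squarefree c ∧ ∀ ℓ ∈ c.primeFactors,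
      Zhang2014.IsKolyvaginPrime (W.conductorNorm ℤ) W K p ℓ})
    (hk : 1 ≤ k) (hmc : m c = mInf) (hMc : (mInf : ℕ∞) + k ≤ Zhang2014.levelIndex W p c.1) :
    ∃ c' : {c : ℕ // Squarefree c ∧ ∀ ℓ ∈ c.primeFactors,
        Zhang2014.IsKolyvaginPrime (W.conductorNorm ℤ) W K p ℓ},
      Jetchev2008.IsGlobalCoreVertex W K ι τ p k c'.1 ∧
      (k : ℕ∞) + mInf ≤ Zhang2014.levelIndex W p c'.1 ∧ m c' ≤ mInf := by
  have hp : p.Prime := Fact.out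
  -- `mdiv c = mInf < M(c)`
  have hlt : mdiv c < Zhang2014.levelIndex W p c.1 := by
    by_contra h
    rw [hmdef, if_neg h] at hmc
    exact ENat.top_ne_coe mInf hmc
  have hmdiv : mdiv c = mInf := by rw [hmdef, if_pos hlt] at hmc; exact hmc
  -- a datum of exact depth `mInf`
  have hDv : ∀ d : KolyvaginHeegnerData Dt β ι c.1,
      ∃ Q : (W.baseChange (ringClassField K ι c.1)).toAffine.Point,
        ((p ^ mInf : ℕ) : ℤ) • Q = d.derivedPoint := (hchar c mInf).mp hmdiv.symm.le
  have hnotDv : ¬ ∀ d : KolyvaginHeegnerData Dt β ι c.1,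
      ∃ Q : (W.baseChange (ringClassField K ι c.1)).toAffine.Point,
        ((p ^ (mInf + 1) : ℕ) : ℤ) • Q = d.derivedPoint := by
    intro h
    have := (hchar c (mInf + 1)).mpr h
    rw [hmdiv, ENat.coe_le_coe] at this
    omega
  obtain ⟨d', hnd'⟩ := not_forall.mp hnotDv
  have hdiv' := hDv d'
  -- the derived point of `d'` is not torsion: `E(K[c])[p] = 0` from IRREDUCIBILITY (x11b3)
  have hc0 : c.1 ≠ 0 := c.2.1.ne_zero
  have hpc : ¬ p ∣ c.1 := fun h ↦
    (c.2.2 p (Nat.mem_primeFactors.mpr ⟨hp, h, hc0⟩)).2.2.2.1 rfl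
  have hbot := X11b.NoTorsionIrr.torsionBy_ringClassField_eq_bot_of_hasIrreducibleModPGaloisRep W hK ι hc0 hp
    hp2 hirr (WeierstrassCurve.exists_weilPairing_holds W p)
    (X11b.isUnramifiedIn_of_satisfiesHeegnerHypothesis_of_dvd hK hH hp hpN) hpc
  have hA : ∀ R : (W.baseChange (ringClassField K ι c.1)).toAffine.Point, (p : ℤ) • R = 0 → R = 0 := by
    intro R hR
    have hmem : R ∈ AddSubgroup.torsionBy (W.baseChange (ringClassField K ι c.1)).toAffine.Point (p : ℤ) := by
      rw [mem_torsionBy_iff]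
      exact hR
    rw [hbot] at hmem
    exact hmem
  have hnt : ¬ IsOfFinAddOrder d'.derivedPoint :=
    fun hfin ↦ hnd' (JET.exists_pow_smul_eq_of_isOfFinAddOrder hp hA hfin (mInf + 1))
  -- `c ∈ Λ_{mInf + k}`
  have hsM : ((mInf + k : ℕ) : ℕ∞) ≤ Zhang2014.levelIndex W p c.1 := by push_cast; exact hMc
  -- the irreducible reading of Prop. 5.3
  obtain ⟨c', d'', hsq', hℓ', hcore, -, hnd''⟩ := hCVI W hcm K hK hD3 hD4 hH τ hτ p hp2 hirr
    (Int.natCast_dvd_natCast.mpr hpN) Dt β ι d₁ hy k hk c.1 d' c.2.1 c.2.2 mInf hnt hdiv' hnd' hsM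
  let cc : {c : ℕ // Squarefree c ∧ ∀ ℓ ∈ c.primeFactors,
      Zhang2014.IsKolyvaginPrime (W.conductorNorm ℤ) W K p ℓ} := ⟨c', hsq', fun ℓ h ↦ (hℓ' ℓ h).1⟩
  have hM' : (k : ℕ∞) + mInf ≤ Zhang2014.levelIndex W p c' := by
    have := Zhang2014.natCast_le_levelIndex_iff.mpr fun ℓ h ↦ (hℓ' ℓ h).2
    push_cast at this
    exact this
  refine ⟨cc, hcore, hM', ?_⟩
  -- `m(c') ≤ mInf`: the datum `d''` is not divisible to depth `mInf + 1`
  have hle : mdiv cc ≤ mInf := by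
    have h1 : ¬ ((mInf + 1 : ℕ) : ℕ∞) ≤ mdiv cc := fun h ↦ hnd'' ((hchar cc (mInf + 1)).mp h d'')
    rw [not_le] at h1
    have h2 : mdiv cc < (mInf : ℕ∞) + 1 := by exact_mod_cast h1
    exact (ENat.lt_add_one_iff (ENat.coe_ne_top mInf)).mp h2
  have hlt' : mdiv cc < Zhang2014.levelIndex W p cc.1 := by
    refine lt_of_le_of_lt hle (lt_of_lt_of_le ?_ hM')
    have h1 : (mInf : ℕ∞) < (mInf : ℕ∞) + 1 :=
      (ENat.lt_add_one_iff (ENat.coe_ne_top mInf)).mpr le_rfl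
    calc (mInf : ℕ∞) < (mInf : ℕ∞) + 1 := h1
      _ ≤ (k : ℕ∞) + mInf := by
        rw [add_comm]
        exact add_le_add_left (by exact_mod_cast hk) _
  rw [hmdef, if_pos hlt']
  exact hle

/-! ### §2 `h52row` from the PRIMED irreducible reading of McCallum Prop. 5.2 -/

/-- **`h52row` for a row with `E[p]` IRREDUCIBLE and `p ∣ N_E`, from the PRIMED reading `h52I`** (=
`Sig.stub_prop52IrredP`). Proof = `prop52Row_of_prop52Irred` (Prop. 5.2 at `M := max m' (M_r + 1)`), binder fed from `hpN`.
[cite: McCallumLMS1991, §5 Prop. 5.2 (p. 304)] [cite: Jetchev2008, Rem. 6.2] -/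
theorem prop52Row_of_prop52IrredP
    (h52I : ∀ (W : WeierstrassCurve ℚ) [W.IsElliptic] [W.IsGloballyMinimal] [NeZero (W.conductorNorm ℤ)],
        ¬ W.HasCM →
        ∀ (K : Type) [Field K] [NumberField K], IsImaginaryQuadratic K →
        NumberField.discr K ≠ -3 → NumberField.discr K ≠ -4 →
        SatisfiesHeegnerHypothesis (W.conductorNorm ℤ) K →
        ∀ (p : ℕ) [Fact p.Prime], p ≠ 2 → W.HasIrreducibleModPGaloisRep p → (p : ℤ) ∣ W.conductorNorm ℤ →
        ∀ (Dt : ModularParametrizationData W (W.conductorNorm ℤ)) (β : ℤ) (ι : K →+* ℂ)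
          (d₁ : KolyvaginHeegnerData Dt β ι 1), ¬ IsOfFinAddOrder d₁.derivedPoint →
        ∀ (r : ℕ), 0 < r →
        ∀ (Mr : ℕ),
          IsLeast {u : ℕ | ∃ (n : ℕ) (d : KolyvaginHeegnerData Dt β ι n), Squarefree n ∧
              n.primeFactors.card = r ∧
              (∀ ℓ ∈ n.primeFactors, Zhang2014.IsKolyvaginPrime (W.conductorNorm ℤ) W K p ℓ ∧
                u + 1 ≤ Zhang2014.kolyvaginIndex W p ℓ) ∧
              (∃ Q : (W.baseChange (ringClassField K ι n)).toAffine.Point,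
                ((p ^ u : ℕ) : ℤ) • Q = d.derivedPoint) ∧
              ¬ ∃ Q : (W.baseChange (ringClassField K ι n)).toAffine.Point,
                ((p ^ (u + 1) : ℕ) : ℤ) • Q = d.derivedPoint} Mr →
        ∀ (M : ℕ), Mr < M →
          ∃ (n : ℕ) (d : KolyvaginHeegnerData Dt β ι n), Squarefree n ∧ n.primeFactors.card = r ∧
            (∀ ℓ ∈ n.primeFactors, Zhang2014.IsKolyvaginPrime (W.conductorNorm ℤ) W K p ℓ ∧
              M ≤ Zhang2014.kolyvaginIndex W p ℓ) ∧
            addOrderOf (d.kolyvaginClass (Fact.out : p.Prime) M) = p ^ (M - Mr) ∧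
            (∃ Q : (W.baseChange (ringClassField K ι n)).toAffine.Point,
              ((p ^ Mr : ℕ) : ℤ) • Q = d.derivedPoint) ∧
            ¬ ∃ Q : (W.baseChange (ringClassField K ι n)).toAffine.Point,
              ((p ^ (Mr + 1) : ℕ) : ℤ) • Q = d.derivedPoint)
    (W : WeierstrassCurve ℚ) [W.IsElliptic] [W.IsGloballyMinimal] [NeZero (W.conductorNorm ℤ)]
    (hcm : ¬ W.HasCM) (K : Type) [Field K] [NumberField K] (hK : IsImaginaryQuadratic K)
    (hD3 : NumberField.discr K ≠ -3) (hD4 : NumberField.discr K ≠ -4)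
    (hH : SatisfiesHeegnerHypothesis (W.conductorNorm ℤ) K)
    (p : ℕ) [Fact p.Prime] (hp2 : p ≠ 2) (hirr : W.HasIrreducibleModPGaloisRep p)
    (hpN : p ∣ W.conductorNorm ℤ)
    (Dt : ModularParametrizationData W (W.conductorNorm ℤ)) (β : ℤ) (ι : K →+* ℂ)
    (d₁ : KolyvaginHeegnerData Dt β ι 1) (hy : ¬ IsOfFinAddOrder d₁.derivedPoint)
    (r : ℕ) (hr : 0 < r) (Mr : ℕ)
    (hMr : IsLeast {u : ℕ | ∃ (n : ℕ) (d : KolyvaginHeegnerData Dt β ι n), Squarefree n ∧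
        n.primeFactors.card = r ∧
        (∀ ℓ ∈ n.primeFactors, Zhang2014.IsKolyvaginPrime (W.conductorNorm ℤ) W K p ℓ ∧
          u + 1 ≤ Zhang2014.kolyvaginIndex W p ℓ) ∧
        (∃ Q : (W.baseChange (ringClassField K ι n)).toAffine.Point,
          ((p ^ u : ℕ) : ℤ) • Q = d.derivedPoint) ∧
        ¬ ∃ Q : (W.baseChange (ringClassField K ι n)).toAffine.Point,
          ((p ^ (u + 1) : ℕ) : ℤ) • Q = d.derivedPoint} Mr)
    (m' : ℕ) :
    ∃ (n : ℕ) (d : KolyvaginHeegnerData Dt β ι n), Squarefree n ∧ n.primeFactors.card = r ∧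
      (∀ ℓ ∈ n.primeFactors, Zhang2014.IsKolyvaginPrime (W.conductorNorm ℤ) W K p ℓ) ∧
      (m' : ℕ∞) ≤ Zhang2014.levelIndex W p n ∧
      (∃ Q : (W.baseChange (ringClassField K ι n)).toAffine.Point,
        ((p ^ Mr : ℕ) : ℤ) • Q = d.derivedPoint) ∧
      ¬ ∃ Q : (W.baseChange (ringClassField K ι n)).toAffine.Point,
        ((p ^ (Mr + 1) : ℕ) : ℤ) • Q = d.derivedPoint := by
  obtain ⟨n, d, hsq, hcard, hℓ, -, hdiv, hndiv⟩ :=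
    h52I W hcm K hK hD3 hD4 hH p hp2 hirr (Int.natCast_dvd_natCast.mpr hpN) Dt β ι d₁ hy r hr Mr hMr
      (max m' (Mr + 1))
      (lt_of_lt_of_le (Nat.lt_succ_self Mr) (le_max_right _ _))
  refine ⟨n, d, hsq, hcard, fun ℓ hℓn ↦ (hℓ ℓ hℓn).1, ?_, hdiv, hndiv⟩
  rw [Zhang2014.natCast_le_levelIndex_iff]
  exact fun ℓ hℓn ↦ (le_max_left _ _).trans (hℓ ℓ hℓn).2

/-! ### §3 S2 of 20165 from the PRIMED readings + ring class fields + Thm. 6.3 for the row objects -/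

/-- **S2 (`Sig.S2DivisibilityIrredAddv` of 20165's skeleton, body VERBATIM) from the PRIMED readings `h52I` /
`hCVI`, `hRCF` and `H63I` (`Sig.H63IRowObjectsAddv`, unchanged)** — the re-issue of k8t-c4 g8's
`divisibilityIrredAddv_of_prop52Irred_of_coreVertexExistenceIrred_of_thm63` (p504855); `p ∣ N_E` DERIVED from `Addv`
and handed to the primed readings. CONDITIONAL; nothing asserted.
[cite: Jetchev2008, Prop. 5.3 (p. 823), Thm. 5.2 (p. 821), Rem. 6.2] [cite: McCallumLMS1991, §5 Prop. 5.2 (p. 304)] -/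
theorem divisibilityIrredAddv_of_prop52IrredP_of_coreVertexExistenceIrredP_of_thm63
    (h52I : ∀ (W : WeierstrassCurve ℚ) [W.IsElliptic] [W.IsGloballyMinimal] [NeZero (W.conductorNorm ℤ)],
        ¬ W.HasCM →
        ∀ (K : Type) [Field K] [NumberField K], IsImaginaryQuadratic K →
        NumberField.discr K ≠ -3 → NumberField.discr K ≠ -4 →
        SatisfiesHeegnerHypothesis (W.conductorNorm ℤ) K →
        ∀ (p : ℕ) [Fact p.Prime], p ≠ 2 → W.HasIrreducibleModPGaloisRep p → (p : ℤ) ∣ W.conductorNorm ℤ →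
        ∀ (Dt : ModularParametrizationData W (W.conductorNorm ℤ)) (β : ℤ) (ι : K →+* ℂ)
          (d₁ : KolyvaginHeegnerData Dt β ι 1), ¬ IsOfFinAddOrder d₁.derivedPoint →
        ∀ (r : ℕ), 0 < r →
        ∀ (Mr : ℕ),
          IsLeast {u : ℕ | ∃ (n : ℕ) (d : KolyvaginHeegnerData Dt β ι n), Squarefree n ∧
              n.primeFactors.card = r ∧
              (∀ ℓ ∈ n.primeFactors, Zhang2014.IsKolyvaginPrime (W.conductorNorm ℤ) W K p ℓ ∧
                u + 1 ≤ Zhang2014.kolyvaginIndex W p ℓ) ∧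
              (∃ Q : (W.baseChange (ringClassField K ι n)).toAffine.Point,
                ((p ^ u : ℕ) : ℤ) • Q = d.derivedPoint) ∧
              ¬ ∃ Q : (W.baseChange (ringClassField K ι n)).toAffine.Point,
                ((p ^ (u + 1) : ℕ) : ℤ) • Q = d.derivedPoint} Mr →
        ∀ (M : ℕ), Mr < M →
          ∃ (n : ℕ) (d : KolyvaginHeegnerData Dt β ι n), Squarefree n ∧ n.primeFactors.card = r ∧
            (∀ ℓ ∈ n.primeFactors, Zhang2014.IsKolyvaginPrime (W.conductorNorm ℤ) W K p ℓ ∧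
              M ≤ Zhang2014.kolyvaginIndex W p ℓ) ∧
            addOrderOf (d.kolyvaginClass (Fact.out : p.Prime) M) = p ^ (M - Mr) ∧
            (∃ Q : (W.baseChange (ringClassField K ι n)).toAffine.Point,
              ((p ^ Mr : ℕ) : ℤ) • Q = d.derivedPoint) ∧
            ¬ ∃ Q : (W.baseChange (ringClassField K ι n)).toAffine.Point,
              ((p ^ (Mr + 1) : ℕ) : ℤ) • Q = d.derivedPoint)
    (hCVI : ∀ (W : WeierstrassCurve ℚ) [W.IsElliptic] [W.IsGloballyMinimal] [NeZero (W.conductorNorm ℤ)],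
        ¬ W.HasCM →
        ∀ (K : Type) [Field K] [NumberField K], IsImaginaryQuadratic K →
        NumberField.discr K ≠ -3 → NumberField.discr K ≠ -4 →
        SatisfiesHeegnerHypothesis (W.conductorNorm ℤ) K →
        ∀ (τ : K ≃ₐ[ℚ] K), τ ≠ 1 →
        ∀ (p : ℕ) [Fact p.Prime], p ≠ 2 → W.HasIrreducibleModPGaloisRep p → (p : ℤ) ∣ W.conductorNorm ℤ →
        ∀ (Dt : ModularParametrizationData W (W.conductorNorm ℤ)) (β : ℤ) (ι : K →+* ℂ)
          [∀ k : ℕ, NumberField (ringClassField K ι k)]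
          (d₁ : KolyvaginHeegnerData Dt β ι 1), ¬ IsOfFinAddOrder d₁.derivedPoint →
        ∀ (m : ℕ), 1 ≤ m →
        ∀ (c : ℕ) (d : KolyvaginHeegnerData Dt β ι c), Squarefree c →
          (∀ ℓ ∈ c.primeFactors, Zhang2014.IsKolyvaginPrime (W.conductorNorm ℤ) W K p ℓ) →
        ∀ (s : ℕ), ¬ IsOfFinAddOrder d.derivedPoint →
          (∃ Q : (W.baseChange (ringClassField K ι c)).toAffine.Point,
            ((p ^ s : ℕ) : ℤ) • Q = d.derivedPoint) →
          (¬ ∃ Q : (W.baseChange (ringClassField K ι c)).toAffine.Point,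
            ((p ^ (s + 1) : ℕ) : ℤ) • Q = d.derivedPoint) →
          ((s + m : ℕ) : ℕ∞) ≤ Zhang2014.levelIndex W p c →
          ∃ (c' : ℕ) (d' : KolyvaginHeegnerData Dt β ι c'), Squarefree c' ∧
            (∀ ℓ ∈ c'.primeFactors, Zhang2014.IsKolyvaginPrime (W.conductorNorm ℤ) W K p ℓ ∧
              m + s ≤ Zhang2014.kolyvaginIndex W p ℓ) ∧
            Jetchev2008.IsGlobalCoreVertex W K ι τ p m c' ∧
            ¬ IsOfFinAddOrder d'.derivedPoint ∧
            ¬ ∃ Q : (W.baseChange (ringClassField K ι c')).toAffine.Point,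
              ((p ^ (s + 1) : ℕ) : ℤ) • Q = d'.derivedPoint)
    (hRCF : ∀ (K : Type) [Field K] [NumberField K] (ι : K →+* ℂ), IsImaginaryQuadratic K →
      ∀ k : ℕ, NumberField (ringClassField K ι k))
    (H63I : ∀ (W : WeierstrassCurve ℚ) [W.IsElliptic] [W.IsGloballyMinimal] [NeZero (W.conductorNorm ℤ)],
      ¬ W.HasCM → ∀ (K : Type) [Field K] [NumberField K], IsImaginaryQuadratic K →
      NumberField.discr K ≠ -3 → NumberField.discr K ≠ -4 →
      SatisfiesHeegnerHypothesis (W.conductorNorm ℤ) K →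
      ∀ (τ : K ≃ₐ[ℚ] K), τ ≠ 1 →
      ∀ (p : ℕ) [Fact p.Prime], p ≠ 2 → Rank1Residual.Addv W p → 0 ≤ padicValRat p W.j →
      W.HasIrreducibleModPGaloisRep p →
      ¬ p ∣ (W.baseChange ℚ_[p]).localTamagawaNumber ℤ_[p] →
      (∀ (q' : ℕ) [Fact q'.Prime], q' ∣ W.conductorNorm ℤ →
        p ∣ (W.baseChange ℚ_[q']).localTamagawaNumber ℤ_[q'] → ¬ q' ^ 2 ∣ W.conductorNorm ℤ) →
      ∀ (Dt : ModularParametrizationData W (W.conductorNorm ℤ)) (β : ℤ) (ι : K →+* ℂ)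
        [∀ k : ℕ, NumberField (ringClassField K ι k)]
        (d₁ : KolyvaginHeegnerData Dt β ι 1), ¬ IsOfFinAddOrder d₁.derivedPoint →
      ∀ (q : ℕ) [Fact q.Prime], q ∣ W.conductorNorm ℤ → ¬ q ^ 2 ∣ W.conductorNorm ℤ → q ≠ p →
      ∀ (mdiv m : {c : ℕ // Squarefree c ∧ ∀ ℓ ∈ c.primeFactors,
          Zhang2014.IsKolyvaginPrime (W.conductorNorm ℤ) W K p ℓ} → ℕ∞),
      (∀ c (u : ℕ), (u : ℕ∞) ≤ mdiv c ↔ ∀ d : KolyvaginHeegnerData Dt β ι c.1,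
        ∃ Q : (W.baseChange (ringClassField K ι c.1)).toAffine.Point,
          ((p ^ u : ℕ) : ℤ) • Q = d.derivedPoint) →
      (∀ c, m c = if mdiv c < Zhang2014.levelIndex W p c.1 then mdiv c else ⊤) →
      ∀ mInf : ℕ, (∀ c, (mInf : ℕ∞) ≤ m c) →
        (∀ m' : ℕ, ∃ c, (m' : ℕ∞) ≤ Zhang2014.levelIndex W p c.1 ∧ m c = mInf) →
      ∀ (k : ℕ) c, 1 ≤ k → Jetchev2008.IsGlobalCoreVertex W K ι τ p k c.1 → m c = mInf →
        (k : ℕ∞) + mInf ≤ Zhang2014.levelIndex W p c.1 →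
        padicValNat p ((W.baseChange ℚ_[q]).localTamagawaNumber ℤ_[q]) < k → mInf < k →
        padicValNat p ((W.baseChange ℚ_[q]).localTamagawaNumber ℤ_[q]) ≤ mInf)
    :
    ∀ (W : WeierstrassCurve ℚ) [W.IsElliptic] [W.IsGloballyMinimal] [NeZero (W.conductorNorm ℤ)],
      ¬ W.HasCM →
      ∀ (K : Type) [Field K] [NumberField K], IsImaginaryQuadratic K →
      NumberField.discr K ≠ -3 → NumberField.discr K ≠ -4 →
      SatisfiesHeegnerHypothesis (W.conductorNorm ℤ) K →
      ∀ (p : ℕ) [Fact p.Prime], p ≠ 2 → Addv W p → 0 ≤ padicValRat p W.j →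
      W.HasIrreducibleModPGaloisRep p →
      ¬ p ∣ (W.baseChange ℚ_[p]).localTamagawaNumber ℤ_[p] →
      (∀ (q' : ℕ) [Fact q'.Prime], q' ∣ W.conductorNorm ℤ →
        p ∣ (W.baseChange ℚ_[q']).localTamagawaNumber ℤ_[q'] → ¬ q' ^ 2 ∣ W.conductorNorm ℤ) →
      ∀ (Dt : ModularParametrizationData W (W.conductorNorm ℤ)) (β : ℤ) (ι : K →+* ℂ)
        (d₁ : KolyvaginHeegnerData Dt β ι 1), ¬ IsOfFinAddOrder d₁.derivedPoint →
      ∀ (q : ℕ) [Fact q.Prime], q ∣ W.conductorNorm ℤ → ¬ q ^ 2 ∣ W.conductorNorm ℤ → q ≠ p →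
      ∀ (s : ℕ), s ≤ padicValNat p ((W.baseChange ℚ_[q]).localTamagawaNumber ℤ_[q]) →
      ∀ (n : ℕ) (d : KolyvaginHeegnerData Dt β ι n), Squarefree n →
        (∀ ℓ ∈ n.primeFactors, Zhang2014.IsKolyvaginPrime (W.conductorNorm ℤ) W K p ℓ ∧
          s ≤ Zhang2014.kolyvaginIndex W p ℓ) →
        ∃ Q : (W.baseChange (ringClassField K ι n)).toAffine.Point,
          ((p ^ s : ℕ) : ℤ) • Q = d.derivedPoint := by
  intro W _ _ _ hcm K _ _ hK hD3 hD4 hH p _ hp2 hadd hj hirr hcp htam Dt β ι d₁ hy q _ hqN hq2 hqp s hs n d hn hℓ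
  have hp : p.Prime := Fact.out
  have hpN : p ∣ W.conductorNorm ℤ := (W.dvd_conductorNorm_iff_not_hasGoodReductionAtPrime p).mpr hadd.1
  obtain ⟨τ, hτ⟩ := exists_algEquiv_ne_one_of_isImaginaryQuadratic K hK
  haveI : ∀ k : ℕ, NumberField (ringClassField K ι k) := hRCF K ι hK
  refine derivedPoint_divisible_of_prop52Row_of_section6_min W K p Dt β ι
    (prop52Row_of_prop52IrredP h52I W hcm K hK hD3 hD4 hH p hp2 hirr hpN Dt β ι d₁ hy) _ ?_ s hs n d hn hℓ
  intro mdiv m hchar hmdef mInf hmInf hKoly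
  exact ⟨fun k c ↦ Jetchev2008.IsGlobalCoreVertex W K ι τ p k c.1,
    fun k c hk hmc hMc ↦ exists_coreVertex_of_coreVertexExistenceIrredP hCVI W hcm K hK hD3 hD4 hH τ hτ p hp2
      hirr hpN Dt β ι d₁ hy mdiv m hchar hmdef mInf k c hk hmc hMc,
    fun k c hk hcore hmc hMc htk hik ↦ H63I W hcm K hK hD3 hD4 hH τ hτ p hp2 hadd hj hirr hcp htam Dt β ι
      d₁ hy q hqN hq2 hqp mdiv m hchar hmdef mInf hmInf hKoly k c hk hcore hmc hMc htk hik⟩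

end Summit.BirchSwinnertonDyer.BirchSwinnertonDyer.Theorems.JetchevIrreducibleReadingDivisibilityPrimed

end
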